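import Literature.Topology.FourManifolds.HomotopySpheresSignatureKilling
import Literature.Topology.FourManifolds.HomotopySpheresSignatureConnectedSumHolds
import Literature.Topology.FourManifolds.HomotopySpheresSignatureLemma74
import HarnessLib

/-!
# Kervaire–Milnor's Cor. 7.6 (`bP₄ₘ` finite cyclic) over its current frontier

Topic `Literature/Topology/FourManifolds`; second pure-proof sibling (after
`HomotopySpheresBPCyclic.lean`) of the named fact
`Literature.Topology.FourManifolds.HomotopySphereClass.isCyclic_bP_four_mul`
(`HomotopySpheresBP.lean`): M. Kervaire, J. Milnor, *Groups of homotopy spheres I*, Ann. of Math.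
77 (1963), **Cor. 7.6** (p. 530): "The group `bP₄ₘ`, `m > 1`, is isomorphic to a subgroup of the
cyclic group of order `σₘ`. Hence `bP₄ₘ` is finite cyclic. The proof is evident." Everything in
this file is **proved**; no definition, no named fact and no statement is added or changed
(D-0026, net debt `0`).

`HomotopySpheresBPCyclic.lean` proves Cor. 7.6 from the five printed inputs of its evident proof,
vendored as named facts in `HomotopySpheresSignature.lean`: Lemma 7.4 (`σₘ ≠ 0`), Thm. 7.5,
additivity of `σ` over connected sums along the boundary (§2) and the two Lemma 3.4 comparisons
(`HomotopySphereClass.isCyclic_bP_four_mul_of_signatureFacts`, pointwise in each dimension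
`HomotopySphereClass.exists_subgroup_coe_eq_bP_of_dim`). Since then three of the five have been
DISCHARGED in the tree —

* §2-additivity: `HomotopySphere.add_mem_signatureSet_of_isOrientedConnectedSum_holds`
  (`HomotopySpheresSignatureConnectedSumHolds.lean`, the boundary connected sum `W_S ♮ W_T`);
* Lemma 3.4 "⇒": `HomotopySphere.nonempty_signatureSet_of_boundsParallelizable_holds` and
* Lemma 3.4 "⇐": `HomotopySphere.boundsParallelizable_of_mem_signatureSet_holds`
  (`HomotopySpheresSignatureProofs.lean`)

— and the other two have been reduced to deeper printed results WITHOUT new named facts: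
Thm. 7.5 to Lemma 7.3 (framed surgery in the middle dimension), Kosinski's X.2.2 (surgery below
it), Smale's h-cobordism theorem and §2-additivity (`HomotopySpheresSignatureReduction.lean`,
`HomotopySpheresSignatureKilling.lean`); Lemma 7.4 as vendored to Lemma 7.4 as printed
(`HomotopySpheresSignatureLemma74.lean`). This file records Cor. 7.6 over the resulting frontier,
in the binder shapes those files use, so that the discharge `isCyclic_bP_four_mul_holds` is the
one-line application of one of the theorems below to the `_holds` of the remaining leaves:

* `HomotopySphereClass.exists_subgroup_coe_eq_bP_of_thm75_of_dim` — Cor. 7.6 in ONE dimension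
  `n = 4m - 1` from exactly two dimension-`n` inputs: Lemma 7.4 at `m` (a non-zero signature occurs
  for the standard `n`-sphere) and Thm. 7.5 at `m`;
  `HomotopySphereClass.exists_subgroup_coe_eq_bP_of_sigmaGen_ne_zero_of_dim` — the same with
  Lemma 7.4 in the form "`σₘ ≠ 0`" in which p. 529 uses it.
* `HomotopySphereClass.isCyclic_bP_four_mul_of_thm75` — **the named fact from Lemma 7.4 for
  `m > 1` only and Thm. 7.5** (`HomotopySphere.mk_eq_mk_iff_sigmaGen_dvd_sub`). Lemma 7.4 is taken
  only in the dimensions `4m - 1 ≥ 7` of Cor. 7.6: the vendored fact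
  `HomotopySphere.exists_mem_signatureSet_sphere_ne_zero` also covers `m = 1` (an s-parallelizable
  `4`-manifold bounded by `S³` with `σ ≠ 0`, i.e. a `K3` surface minus a disc), which Cor. 7.6 does
  not use; `HomotopySphereClass.isCyclic_bP_four_mul_of_sigmaGen_ne_zero` — with "`σₘ ≠ 0` for
  `m > 1`" instead.
* `HomotopySphereClass.isCyclic_bP_four_mul_of_isParallelizable` — with Lemma 7.4 **as printed**
  (p. 529: for each `m > 1` a connected parallelizable `M₀` with `bM₀` the ordinary `(4m-1)`-sphere
  and `σ(M₀) ≠ 0`), through `HomotopySphere.exists_mem_signatureSet_sphere_of_isParallelizable`.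
* `HomotopySphereClass.isCyclic_bP_four_mul_of_boundsContractible` — with Thm. 7.5 replaced by its
  three inputs of `HomotopySphere.mk_eq_mk_iff_sigmaGen_dvd_sub_of_boundsContractible`: Lemma 7.3
  as invoked on p. 530 (`h73`: a homotopy sphere bounding an s-parallelizable `M` with `σ(M) = 0`
  bounds a contractible manifold), Smale's h-cobordism theorem (the named fact
  `nonempty_diffeomorph_of_isHCobordant_of_five_le`) and §2-additivity, the last now discharged.
* `HomotopySphereClass.isCyclic_bP_four_mul_of_killMiddleHomology` — with Lemma 7.3 split further
  as in `HomotopySphere.mk_eq_mk_iff_sigmaGen_dvd_sub_of_killMiddleHomology`: its surgical content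
  "`H₂ₘM` can be killed" (`hkill`, Kervaire–Milnor pp. 528–529 with Thm. 6.6; Kosinski X.3.4) and
  Kosinski's X.2.2 (the named fact `HomotopySphere.exists_highlyConnected_of_mem_signatureSet`),
  the last clause of Thm. 6.6 being the theorem
  `NullCobordism.contractibleSpace_of_isZero_singularHomology_le`.

So the printed results separating the tree from `isCyclic_bP_four_mul_holds` are exactly: Lemma
7.4 as printed for `m ≥ 2` (Milnor–Kervaire 1958: closed almost parallelizable `4m`-manifolds with
`σ ≠ 0` — Bott periodicity, finiteness of the stable stems, Hirzebruch's signature theorem),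
framed surgery below (Kosinski X.2.2 / Thm. 5.5) and in (Lemma 7.3 / Thm. 6.6) the middle
dimension, and the h-cobordism theorem (Milnor 1965, Thm. 9.1).

## References

* M. Kervaire, J. Milnor, *Groups of homotopy spheres I*, Ann. of Math. 77 (1963), 504–537: §2
  (pp. 505–508), Lemma 3.4 (p. 509), §4 (p. 512), Thm. 6.6 (p. 526), Lemma 7.3 (pp. 528–529),
  Lemma 7.4 and the definition of `σₘ` (p. 529), Thm. 7.5 (pp. 529–530), Cor. 7.6 (p. 530).
  doi:10.2307/1970128 [KervaireMilnorAnnals1963]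
* J. Milnor, M. Kervaire, *Bernoulli numbers, homotopy groups, and a theorem of Rohlin*, Proc.
  ICM Edinburgh 1958, CUP 1960, 454–458 (reference [18] of the printed proof of Lemma 7.4).
* A. Kosinski, *Differential Manifolds* (1993), Ch. X, Thm. (2.2), Thm. (3.4), §6 Prop. 6.2(a).
  [Kosinski1993]
* J. Milnor, *Lectures on the h-cobordism theorem*, Princeton (1965), Thm. 9.1.
  [MilnorHCobordism1965]
-/

open scoped Manifold ContDiff Topology
open Set Function
open Literature.AlgebraicTopology.SingularHomology

noncomputable section

namespace Literature.Topology.FourManifolds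

namespace HomotopySphereClass

open HomotopySphere

variable {n : ℕ}

/-! ### Cor. 7.6 in one dimension from Lemma 7.4 and Thm. 7.5 in that dimension -/

/-- **Kervaire–Milnor Cor. 7.6 in one dimension, from Lemma 7.4 and Thm. 7.5 in that dimension.**
Let `n + 1 = 4m`, fix a commutative group structure on `Θₙ = HomotopySphereClass n` whose
multiplication is the connected sum and a generator convention `g` for `Hₙ(ℝⁿ | pt; ℤ)`. If
(Lemma 7.4 at `m`) some non-zero integer is the signature of an oriented s-parallelizable manifold
bounded by the standard `n`-sphere, and (Thm. 7.5 at `m`) for homotopy spheres `Σ₁`, `Σ₂` bounding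
oriented s-parallelizable `M₁`, `M₂`, `[Σ₁] = [Σ₂] ↔ σₘ ∣ σ(M₁) - σ(M₂)`, then `bPₙ₊₁ = bP n` is the
carrier of a finite cyclic subgroup of `Θₙ` (p. 530: "`bP₄ₘ` … is isomorphic to a subgroup of the
cyclic group of order `σₘ`. Hence `bP₄ₘ` is finite cyclic"). This is
`exists_subgroup_coe_eq_bP_of_dim` with its other three printed inputs now theorems of the tree:
§2-additivity (`add_mem_signatureSet_of_isOrientedConnectedSum_holds`) and the two Lemma 3.4
comparisons (`nonempty_signatureSet_of_boundsParallelizable_holds`,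
`boundsParallelizable_of_mem_signatureSet_holds`); products exist in `Θₙ`, `n ≥ 3`
(`isMul_exists_of_three_le`). [cite: KervaireMilnorAnnals1963, Cor. 7.6 (p. 530), from Lemma 7.4 and Thm. 7.5 (p. 529), with §2, Lemma 3.4 and §4 (p. 512)] -/
theorem exists_subgroup_coe_eq_bP_of_thm75_of_dim {m : ℕ} (h : n + 1 = 4 * m)
    [CommGroup (HomotopySphereClass n)]
    (hcompat : ∀ a b c : HomotopySphereClass n, IsMul a b c → a * b = c)
    (g : HomologicalOrientation ℤ (EuclideanSpace ℝ (Fin n)) n)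
    (h74 : ∃ (o : SmoothOrientation (𝓡 n) (Metric.sphere (0 : EuclideanSpace ℝ (Fin (n + 1))) 1))
      (σ : ℤ),
      σ ∈ signatureSet g m h ⟨Metric.sphere (0 : EuclideanSpace ℝ (Fin (n + 1))) 1, o, ⟨.refl _⟩⟩
        ∧ σ ≠ 0)
    (h75 : ∀ (S T : HomotopySphere n) (σ τ : ℤ), σ ∈ signatureSet g m h S →
      τ ∈ signatureSet g m h T → (mk S = mk T ↔ (sigmaGen g m h : ℤ) ∣ σ - τ)) :
    ∃ H : Subgroup (HomotopySphereClass n),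
      (H : Set (HomotopySphereClass n)) = bP n ∧ IsCyclic H ∧ Finite H :=
  exists_subgroup_coe_eq_bP_of_dim h hcompat g h74 h75
    (add_mem_signatureSet_of_isOrientedConnectedSum_holds n m h g)
    (nonempty_signatureSet_of_boundsParallelizable_holds n m h g)
    (boundsParallelizable_of_mem_signatureSet_holds n m h g)
    (isMul_exists_of_three_le (n := n) (by omega) (by omega))

/-- **Kervaire–Milnor Cor. 7.6 in one dimension from "`σₘ ≠ 0`" and Thm. 7.5 in that dimension**
— the form in which p. 529 uses Lemma 7.4 ("Thus there exists an s-parallelizable manifold `M₀`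
… with `σ(M₀) ≠ 0` … Let `σₘ > 0` denote the generator of this group"): if `σₘ ≠ 0` (the tree's
`sigmaGen g m h`, with junk value `0` for the trivial group) then some non-zero signature occurs
for the standard sphere — otherwise the subgroup the signatures generate
(`sphereSignatureSubgroup`) would be trivial and `σₘ = sInf ∅ = 0` — and
`exists_subgroup_coe_eq_bP_of_thm75_of_dim` applies. [cite: KervaireMilnorAnnals1963, Cor. 7.6 (p. 530), with p. 529 (definition of σₘ) and Thm. 7.5] -/
theorem exists_subgroup_coe_eq_bP_of_sigmaGen_ne_zero_of_dim {m : ℕ} (h : n + 1 = 4 * m)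
    [CommGroup (HomotopySphereClass n)]
    (hcompat : ∀ a b c : HomotopySphereClass n, IsMul a b c → a * b = c)
    (g : HomologicalOrientation ℤ (EuclideanSpace ℝ (Fin n)) n) (hσ : sigmaGen g m h ≠ 0)
    (h75 : ∀ (S T : HomotopySphere n) (σ τ : ℤ), σ ∈ signatureSet g m h S →
      τ ∈ signatureSet g m h T → (mk S = mk T ↔ (sigmaGen g m h : ℤ) ∣ σ - τ)) :
    ∃ H : Subgroup (HomotopySphereClass n),
      (H : Set (HomotopySphereClass n)) = bP n ∧ IsCyclic H ∧ Finite H := by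
  refine exists_subgroup_coe_eq_bP_of_thm75_of_dim h hcompat g ?_ h75
  -- if every signature for the standard sphere vanished, `σₘ` would be the junk value `0`
  by_contra hcon
  push Not at hcon
  refine hσ ?_
  have hbot : sphereSignatureSubgroup g m h = ⊥ := by
    rw [sphereSignatureSubgroup, AddSubgroup.closure_eq_bot_iff]
    intro σ hσ'
    obtain ⟨o, ho⟩ := mem_iUnion.1 hσ'
    exact hcon o σ ho
  have hempty : {k : ℕ | 0 < k ∧ (k : ℤ) ∈ sphereSignatureSubgroup g m h} = ∅ := by
    ext k
    simp only [hbot, AddSubgroup.mem_bot, Nat.cast_eq_zero, mem_setOf_eq, mem_empty_iff_false,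
      iff_false, not_and]
    omega
  rw [sigmaGen, hempty, Nat.sInf_empty]

/-! ### The named fact from Lemma 7.4 for `m > 1` and Thm. 7.5 -/

/-- **Kervaire–Milnor Cor. 7.6 from Lemma 7.4 for `m > 1` and Thm. 7.5.** The named fact
`HomotopySphereClass.isCyclic_bP_four_mul` follows from: (`h74`) Lemma 7.4 in the dimensions
`n = 4m - 1`, `m > 1`, of Cor. 7.6 — for every generator convention `g` some non-zero integer is
the signature of an oriented s-parallelizable manifold bounded by the standard `n`-sphere (the
vendored fact `exists_mem_signatureSet_sphere_ne_zero` restricted to `m > 1`; its case `m = 1` is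
not used by Cor. 7.6); (`h75`) Thm. 7.5, the named fact `mk_eq_mk_iff_sigmaGen_dvd_sub`. The
other printed inputs — §2-additivity, Lemma 3.4, products in `Θₙ`, a generator convention for
`Hₙ(ℝⁿ | pt; ℤ)` — are theorems of the tree (`exists_subgroup_coe_eq_bP_of_thm75_of_dim`,
`isOrientableOver_int_euclideanSpace`). [cite: KervaireMilnorAnnals1963, Cor. 7.6 (p. 530), from Lemma 7.4 (p. 529) and Thm. 7.5 (pp. 529–530)] -/
theorem isCyclic_bP_four_mul_of_thm75
    (h74 : ∀ (n m : ℕ) (h : n + 1 = 4 * m), 1 < m →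
      ∀ g : HomologicalOrientation ℤ (EuclideanSpace ℝ (Fin n)) n,
        ∃ (o : SmoothOrientation (𝓡 n) (Metric.sphere (0 : EuclideanSpace ℝ (Fin (n + 1))) 1))
          (σ : ℤ),
        σ ∈ signatureSet g m h ⟨Metric.sphere (0 : EuclideanSpace ℝ (Fin (n + 1))) 1, o, ⟨.refl _⟩⟩
          ∧ σ ≠ 0)
    (h75 : mk_eq_mk_iff_sigmaGen_dvd_sub) :
    isCyclic_bP_four_mul := by
  intro m n hm h inst hcompat
  -- a generator convention for `Hₙ(ℝⁿ | pt; ℤ)` (Hatcher Prop. 3.25 for the contractible `ℝⁿ`)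
  obtain ⟨g⟩ := isOrientableOver_int_euclideanSpace n
  exact exists_subgroup_coe_eq_bP_of_thm75_of_dim h hcompat g (h74 n m h hm g) (h75 n m h hm g)

/-- **Kervaire–Milnor Cor. 7.6 from "`σₘ ≠ 0` for `m > 1`" and Thm. 7.5** (p. 529: "Let `σₘ > 0`
denote the generator of this group"; p. 530: "isomorphic to a subgroup of the cyclic group of
order `σₘ`"): the named fact `isCyclic_bP_four_mul` from (`hσ`) `sigmaGen g m h ≠ 0` for every
`n + 1 = 4m`, `m > 1`, and every generator convention `g` — by
`exists_mem_signatureSet_sphere_ne_zero_iff_sigmaGen_ne_zero` this is Lemma 7.4 as vendored,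
restricted to `m > 1` — and (`h75`) the named fact `mk_eq_mk_iff_sigmaGen_dvd_sub`.
[cite: KervaireMilnorAnnals1963, Cor. 7.6 (p. 530), with p. 529 (σₘ) and Thm. 7.5] -/
theorem isCyclic_bP_four_mul_of_sigmaGen_ne_zero
    (hσ : ∀ (n m : ℕ) (h : n + 1 = 4 * m), 1 < m →
      ∀ g : HomologicalOrientation ℤ (EuclideanSpace ℝ (Fin n)) n, sigmaGen g m h ≠ 0)
    (h75 : mk_eq_mk_iff_sigmaGen_dvd_sub) :
    isCyclic_bP_four_mul := by
  intro m n hm h inst hcompat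
  obtain ⟨g⟩ := isOrientableOver_int_euclideanSpace n
  exact exists_subgroup_coe_eq_bP_of_sigmaGen_ne_zero_of_dim h hcompat g (hσ n m h hm g)
    (h75 n m h hm g)

/-- **Kervaire–Milnor Cor. 7.6 from Lemma 7.4 as printed (for `m > 1`) and Thm. 7.5.** Hypothesis
`H` is Lemma 7.4 verbatim up to the tree's vocabulary (p. 529: "For each `k = 2m` there exists a
parallelizable manifold `M₀` whose boundary `bM₀` is the ordinary `(4m - 1)`-sphere, such that the
signature `σ(M₀)` is non-zero"), in the dimensions of Cor. 7.6: for `n + 1 = 4m`, `m > 1`, a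
null-cobordism `c` of the standard sphere `𝕊ⁿ` with `M₀ = c.W` connected and parallelizable and
`σ(M₀) ≠ 0`, the signature of the cup-product form of the closed model `M₀ ∪ cone(bM₀)` (footnote
pp. 528–529) in some orientation `μ'`. The orientation clauses of `signatureSet (𝕊ⁿ, o)` are then
free (`exists_mem_signatureSet_sphere_of_isParallelizable`, `HomotopySpheresSignatureLemma74.lean`),
and `isCyclic_bP_four_mul_of_thm75` applies. `H` is what the printed proof takes from
Milnor–Kervaire [18, p. 457] (a closed almost parallelizable `4m`-manifold with `σ ≠ 0`, minus the
interior of a disc); it is not proved in the tree. [cite: KervaireMilnorAnnals1963, Cor. 7.6 (p. 530), with Lemma 7.4 and its proof (p. 529) and Thm. 7.5] -/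
theorem isCyclic_bP_four_mul_of_isParallelizable
    (H : ∀ (n m : ℕ) (h : n + 1 = 4 * m), 1 < m →
      ∃ c : NullCobordism n (Metric.sphere (0 : EuclideanSpace ℝ (Fin (n + 1))) 1),
        ConnectedSpace c.W ∧ IsParallelizable (𝓡∂ (n + 1)) c.W ∧
          ∃ μ' : HomologicalOrientation ℤ (ClosedModel n c.W) (n + 1),
            μ'.signatureInDim (show 2 * m + 2 * m = n + 1 by omega) ≠ 0)
    (h75 : mk_eq_mk_iff_sigmaGen_dvd_sub) :
    isCyclic_bP_four_mul := by
  refine isCyclic_bP_four_mul_of_thm75 (fun n m h hm g => ?_) h75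
  obtain ⟨c, hconn, hpar, μ', hσ⟩ := H n m h hm
  obtain ⟨o, ho⟩ := exists_mem_signatureSet_sphere_of_isParallelizable h g c hpar μ'
  exact ⟨o, _, ho, hσ⟩

/-! ### The named fact over the frontier of Thm. 7.5 -/

/-- **Kervaire–Milnor Cor. 7.6 from Lemma 7.4 (`m > 1`), Lemma 7.3 and the h-cobordism theorem.**
The named fact `isCyclic_bP_four_mul` from: (`h74`) Lemma 7.4 in the dimensions `4m - 1`, `m > 1`;
(`h73`) Lemma 7.3 in the form in which the proof of Thm. 7.5 invokes it (p. 530: "since `σ(M) = 0`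
it follows from 7.3 that `bM` belongs to the trivial h-cobordism class"; Lemma 7.3, p. 528, with
Thm. 6.6, p. 526, and `bM₁ = bM`, p. 514) — for `n + 1 = 4m`, `m > 1`, a homotopy `n`-sphere
bounding a compact s-parallelizable `M` with `σ(M) = 0` bounds a contractible manifold; (`hcob`)
Smale's h-cobordism theorem, the named fact `nonempty_diffeomorph_of_isHCobordant_of_five_le`
(Remark p. 505; Milnor 1965, Thm. 9.1), which also yields the group `Θₙ` of Thm. 1.1. Thm. 7.5 is
then the theorem `mk_eq_mk_iff_sigmaGen_dvd_sub_of_boundsContractible`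
(`HomotopySpheresSignatureReduction.lean`), its third input, §2-additivity, being discharged
(`add_mem_signatureSet_of_isOrientedConnectedSum_holds`). [cite: KervaireMilnorAnnals1963, Cor. 7.6 (p. 530), with Thm. 7.5 (pp. 529–530), Lemma 7.3 (p. 528), Lemma 7.4 (p. 529) and Remark p. 505] [cite: MilnorHCobordism1965, Thm. 9.1] -/
theorem isCyclic_bP_four_mul_of_boundsContractible
    (h74 : ∀ (n m : ℕ) (h : n + 1 = 4 * m), 1 < m →
      ∀ g : HomologicalOrientation ℤ (EuclideanSpace ℝ (Fin n)) n,
        ∃ (o : SmoothOrientation (𝓡 n) (Metric.sphere (0 : EuclideanSpace ℝ (Fin (n + 1))) 1))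
          (σ : ℤ),
        σ ∈ signatureSet g m h ⟨Metric.sphere (0 : EuclideanSpace ℝ (Fin (n + 1))) 1, o, ⟨.refl _⟩⟩
          ∧ σ ≠ 0)
    (h73 : ∀ (n m : ℕ) (h : n + 1 = 4 * m), 1 < m →
      ∀ (g : HomologicalOrientation ℤ (EuclideanSpace ℝ (Fin n)) n) (S : HomotopySphere n),
        (0 : ℤ) ∈ signatureSet g m h S → BoundsContractible n S.carrier)
    (hcob : FourManifolds.nonempty_diffeomorph_of_isHCobordant_of_five_le.{0}) :
    isCyclic_bP_four_mul :=
  isCyclic_bP_four_mul_of_thm75 h74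
    (mk_eq_mk_iff_sigmaGen_dvd_sub_of_boundsContractible h73 hcob
      add_mem_signatureSet_of_isOrientedConnectedSum_holds)

/-- **Kervaire–Milnor Cor. 7.6 from Lemma 7.4 (`m > 1`), "`H₂ₘM` can be killed", Kosinski's X.2.2
and the h-cobordism theorem** — the deepest current leaves of Thm. 7.5
(`mk_eq_mk_iff_sigmaGen_dvd_sub_of_killMiddleHomology`, `HomotopySpheresSignatureKilling.lean`):
(`h74`) Lemma 7.4 in the dimensions `4m - 1`, `m > 1`; (`hkill`) the surgical content of Lemma 7.3
(pp. 528–529: "Thus `M` satisfies the hypothesis of 7.1. It follows that `H_kM` can be killed";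
Thm. 6.6, p. 526; Kosinski X.3.4) — for `n + 1 = 4m`, `m > 1`, a homotopy `n`-sphere `Σ = bM` with
`M` compact, simply connected, `Hᵢ(M; ℤ) = 0` for `0 < i < 2m`, s-parallelizable and `σ(M) = 0`
also bounds a simply connected `M₁` with `Hᵢ(M₁; ℤ) = 0` for `0 < i ≤ 2m`; (`hconn`) Kosinski's
X.2.2, the named fact `exists_highlyConnected_of_mem_signatureSet` (framed surgery below the middle
dimension); (`hcob`) Smale's h-cobordism theorem, the named fact
`nonempty_diffeomorph_of_isHCobordant_of_five_le`. The last clause of Thm. 6.6 (`M₁` is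
contractible) and §2-additivity are theorems of the tree
(`NullCobordism.contractibleSpace_of_isZero_singularHomology_le`,
`add_mem_signatureSet_of_isOrientedConnectedSum_holds`). [cite: KervaireMilnorAnnals1963, Cor. 7.6 (p. 530), with Thm. 7.5, Lemma 7.3 (pp. 528–529), Thm. 6.6 (p. 526) and Lemma 7.4 (p. 529)] [cite: Kosinski1993, Ch. X, Thm. (2.2) and Thm. (3.4)] [cite: MilnorHCobordism1965, Thm. 9.1] -/
theorem isCyclic_bP_four_mul_of_killMiddleHomology
    (h74 : ∀ (n m : ℕ) (h : n + 1 = 4 * m), 1 < m →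
      ∀ g : HomologicalOrientation ℤ (EuclideanSpace ℝ (Fin n)) n,
        ∃ (o : SmoothOrientation (𝓡 n) (Metric.sphere (0 : EuclideanSpace ℝ (Fin (n + 1))) 1))
          (σ : ℤ),
        σ ∈ signatureSet g m h ⟨Metric.sphere (0 : EuclideanSpace ℝ (Fin (n + 1))) 1, o, ⟨.refl _⟩⟩
          ∧ σ ≠ 0)
    (hkill : ∀ (n m : ℕ) (h : n + 1 = 4 * m), 1 < m →
      ∀ (S : HomotopySphere n) (c : NullCobordism n S.carrier)
        (μ' : HomologicalOrientation ℤ (ClosedModel n c.W) (n + 1)),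
        SimplyConnectedSpace c.W →
        (∀ i : ℕ, 0 < i → i < 2 * m → Subsingleton (singularHomology ℤ ℤ c.W i)) →
        IsStablyParallelizable (𝓡∂ (n + 1)) c.W →
          μ'.signatureInDim (show 2 * m + 2 * m = n + 1 by omega) = 0 →
            ∃ c₁ : NullCobordism n S.carrier, SimplyConnectedSpace c₁.W ∧
              ∀ i : ℕ, 0 < i → i ≤ 2 * m → Subsingleton (singularHomology ℤ ℤ c₁.W i))
    (hconn : exists_highlyConnected_of_mem_signatureSet)
    (hcob : FourManifolds.nonempty_diffeomorph_of_isHCobordant_of_five_le.{0}) :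
    isCyclic_bP_four_mul :=
  isCyclic_bP_four_mul_of_thm75 h74
    (mk_eq_mk_iff_sigmaGen_dvd_sub_of_killMiddleHomology hkill hconn hcob
      add_mem_signatureSet_of_isOrientedConnectedSum_holds)

end HomotopySphereClass

end Literature.Topology.FourManifolds
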